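import Literature.Geometry.Manifold.CoveringSpaceManifold
import HarnessLib

/-!
# Invariant functions on the infinite cyclic cover descend to the base; equivariant functions
are `level + (function on the base)`

For the infinite cyclic cover `X̂ = CircleMaps.CyclicCover f` of a space `X` along `f : X → S¹`
(`InfiniteCyclicCover.lean`: projection `proj`, level function `level` with
`level (k +ᵥ x̂) = level x̂ + 2πk`, deck action of `ℤ`), and a map `F : X̂ → Y`:

* `descendInvariant f F : X → Y` — **the descent of a deck-invariant map** (`F (k +ᵥ x̂) = F x̂`):
  `descendInvariant f F ∘ proj = F` (`descendInvariant_proj`), unique with this property,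
  continuous when `F` is (`proj` is a quotient map), `C^n` when `F` is on a `C^∞` manifold `X`
  (`proj` is a local diffeomorphism, `CoveringSpaceManifold.lean`, Lee 2012, Prop. 4.40), with
  `dF_x̂ = d(descendInvariant f F)_{proj x̂} ∘ dproj_x̂` (`mfderiv_descendInvariant_comp`) and hence
  `dF_x̂ = 0 ↔ d(descendInvariant f F)_{proj x̂} = 0`;
* `exists_eq_level_add_comp_proj` — **every `2π`-equivariant real function is the level function
  plus a function on the base**: `F (k +ᵥ x̂) = F x̂ + 2πk` for all `k, x̂` iff
  `F = level + φ ∘ proj` for a (unique) `φ : X → ℝ`, continuous/`C^n` exactly when `F` is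
  (for `C^n`: `f` smooth, so that `level` is `C^∞`, `contMDiff_level`).

This parametrises the unknowns of fibration problems over the circle posed on the cyclic cover
(an equivariant function without critical points, cf. `EquivariantCircleDescent.lean` and
`AlmostNonnegRicciFibrationCoverReduction.lean`: one looks for `φ : X → ℝ` with
`d(level + φ ∘ proj) ≠ 0`, i.e. for a nowhere-vanishing representative of the closed `1`-form
`f^* dθ + dφ` — Tischler's form of fibering over `S¹`). Everything is proved; the only definition is
the construction `descendInvariant`; no named facts.

## References

* A. Hatcher, *Algebraic Topology*, CUP (2002), §1.3, Prop. 1.39–1.40 (quotients by deck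
  groups). [HatcherAT2002]
* J. M. Lee, *Introduction to Smooth Manifolds*, 2nd ed. (2012), Prop. 4.40, Thm. 4.29
  (smooth covering maps; passing smoothly to the quotient). [LeeSmoothManifolds2013]
-/

noncomputable section

open scoped Manifold ContDiff Topology Real
open Function Set Filter

namespace Literature.Geometry.Manifold

open Literature.Topology.FourManifolds Literature.Topology.FourManifolds.CircleMaps
  Literature.Topology.FourManifolds.CircleMaps.CyclicCover

/-! ### Descent of invariant maps (topology) -/

section Topology

variable {X : Type*} [TopologicalSpace X] (f : C(X, Circle)) {Y : Type*}

/-- **The descent of a deck-invariant map on the cyclic cover**: `descendInvariant f F x = F x̂`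
for the base point `x̂ = base f x` over `x`; for an invariant `F` every point over `x` gives the
same value (`descendInvariant_proj`). [cite: HatcherAT2002, §1.3 Prop. 1.40] -/
def descendInvariant (F : CyclicCover f → Y) (x : X) : Y :=
  F (base f x)

variable {f} {F : CyclicCover f → Y}

/-- **Well-definedness**: for an invariant `F`, `descendInvariant f F (proj x̂) = F x̂` for every
`x̂`. [cite: HatcherAT2002, §1.3 Prop. 1.39] -/
theorem descendInvariant_proj (hF : ∀ (k : ℤ) (x : CyclicCover f), F (k +ᵥ x) = F x)
    (x : CyclicCover f) : descendInvariant f F (proj x) = F x := by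
  obtain ⟨k, hk⟩ := exists_vadd_eq_of_proj_eq (proj_base (f := f) (proj x))
  show F (base f (proj x)) = F x
  rw [← hk, hF]

/-- `descendInvariant f F ∘ proj = F`. [folklore] -/
theorem descendInvariant_comp_proj (hF : ∀ (k : ℤ) (x : CyclicCover f), F (k +ᵥ x) = F x) :
    descendInvariant f F ∘ proj = F :=
  funext (descendInvariant_proj hF)

/-- **Uniqueness**: a map `G : X → Y` with `G ∘ proj = F` is the descended map. [folklore] -/
theorem eq_descendInvariant_of_comp_proj (hF : ∀ (k : ℤ) (x : CyclicCover f), F (k +ᵥ x) = F x)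
    {G : X → Y} (hG : ∀ x : CyclicCover f, G (proj x) = F x) : G = descendInvariant f F := by
  funext y
  obtain ⟨x, rfl⟩ := proj_surjective (f := f) y
  rw [hG, descendInvariant_proj hF]

/-- Invariance under the generator suffices: `F (1 +ᵥ x̂) = F x̂` for all `x̂` gives invariance
under all of `ℤ`. [folklore] -/
theorem invariant_of_one_vadd (hF : ∀ x : CyclicCover f, F ((1 : ℤ) +ᵥ x) = F x) (k : ℤ)
    (x : CyclicCover f) : F (k +ᵥ x) = F x := by
  induction k using Int.induction_on generalizing x with
  | zero => simp
  | succ n ih => rw [add_comm (n : ℤ) 1, add_vadd, hF, ih]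
  | pred n ih =>
    have h := hF ((-(n : ℤ) - 1) +ᵥ x)
    rw [← add_vadd, show (1 : ℤ) + (-(n : ℤ) - 1) = -(n : ℤ) by ring, ih] at h
    exact h.symm

/-- **The descended map is continuous** when `F` is (`proj` is a quotient map).
[cite: HatcherAT2002, §1.3 Prop. 1.40] -/
theorem continuous_descendInvariant [TopologicalSpace Y]
    (hF : ∀ (k : ℤ) (x : CyclicCover f), F (k +ᵥ x) = F x) (hFc : Continuous F) :
    Continuous (descendInvariant f F) := by
  rw [(isQuotientMap_proj (f := f)).continuous_iff, descendInvariant_comp_proj hF]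
  exact hFc

/-- Conversely `F` is continuous when its descent is. [folklore] -/
theorem continuous_of_continuous_descendInvariant [TopologicalSpace Y]
    (hF : ∀ (k : ℤ) (x : CyclicCover f), F (k +ᵥ x) = F x)
    (h : Continuous (descendInvariant f F)) : Continuous F := by
  rw [← descendInvariant_comp_proj hF]
  exact h.comp continuous_proj

end Topology

/-! ### Descent of invariant maps (smoothness) -/

section Smooth

variable {E : Type*} [NormedAddCommGroup E] [NormedSpace ℝ E]
  {H : Type*} [TopologicalSpace H] {I : ModelWithCorners ℝ E H}
  {X : Type*} [TopologicalSpace X] [ChartedSpace H X]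
  {E' : Type*} [NormedAddCommGroup E'] [NormedSpace ℝ E']
  {H' : Type*} [TopologicalSpace H'] {J : ModelWithCorners ℝ E' H'}
  {Y : Type*} [TopologicalSpace Y] [ChartedSpace H' Y]
  (f : C(X, Circle)) {F : CyclicCover f → Y} {n : ℕ∞ω}

/-- **The descended map is `C^n` where `F` is**: near `proj x̂`,
`descendInvariant f F = F ∘ σ` for the local inverse `σ` of the local diffeomorphism `proj` at
`x̂` (Lee 2012, Prop. 4.40 / Thm. 4.29). [cite: LeeSmoothManifolds2013, Prop. 4.40] -/
theorem contMDiffAt_descendInvariant [IsManifold I n X]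
    (hF : ∀ (k : ℤ) (x : CyclicCover f), F (k +ᵥ x) = F x) {x : CyclicCover f}
    (hFs : ContMDiffAt I J n F x) : ContMDiffAt I J n (descendInvariant f F) (proj x) := by
  have hl : IsLocalDiffeomorphAt I I n (proj : CyclicCover f → X) x :=
    isLocalDiffeomorph_cyclicCover_proj f x
  set e := hl.localInverse with he
  have hex : e (proj x) = x := hl.localInverse_left_inv hl.localInverse_mem_target
  have hFs' : ContMDiffAt I J n F (e (proj x)) := by
    rw [hex]
    exact hFs
  have h1 : ContMDiffAt I J n (F ∘ e) (proj x) := hFs'.comp _ hl.localInverse_contMDiffAt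
  refine h1.congr_of_eventuallyEq ?_
  filter_upwards [e.open_source.mem_nhds hl.localInverse_mem_source] with y hy
  show descendInvariant f F y = F (e y)
  rw [← descendInvariant_proj hF (e y), hl.localInverse_right_inv hy]

/-- **The descent of a `C^n` invariant map is `C^n`.** [cite: LeeSmoothManifolds2013, Thm. 4.29] -/
theorem contMDiff_descendInvariant [IsManifold I n X]
    (hF : ∀ (k : ℤ) (x : CyclicCover f), F (k +ᵥ x) = F x) (hFs : ContMDiff I J n F) :
    ContMDiff I J n (descendInvariant f F) := fun y ↦ by
  obtain ⟨x, rfl⟩ := proj_surjective (f := f) y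
  exact contMDiffAt_descendInvariant f hF (hFs x)

/-- Conversely `F` is `C^n` when its descent is (`F = descendInvariant f F ∘ proj`). [folklore] -/
theorem contMDiff_of_contMDiff_descendInvariant [IsManifold I n X]
    (hF : ∀ (k : ℤ) (x : CyclicCover f), F (k +ᵥ x) = F x)
    (h : ContMDiff I J n (descendInvariant f F)) : ContMDiff I J n F := by
  rw [← descendInvariant_comp_proj hF]
  exact h.comp (contMDiff_cyclicCover_proj f)

/-- **Chain rule for the descent**: `dF_x̂ = d(descendInvariant f F)_{proj x̂} ∘ dproj_x̂`
(`n ≥ 1`). [folklore] -/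
theorem mfderiv_descendInvariant_comp [IsManifold I n X] (hn : n ≠ 0)
    (hF : ∀ (k : ℤ) (x : CyclicCover f), F (k +ᵥ x) = F x) {x : CyclicCover f}
    (hFs : ContMDiffAt I J n F x) :
    mfderiv I J F x = (mfderiv I J (descendInvariant f F) (proj x)).comp
      (mfderiv I I (proj : CyclicCover f → X) x) := by
  have hd : MDifferentiableAt I J (descendInvariant f F) (proj x) :=
    (contMDiffAt_descendInvariant f hF hFs).mdifferentiableAt hn
  have hp : MDifferentiableAt I I (proj : CyclicCover f → X) x :=
    (contMDiff_cyclicCover_proj f (I := I) (n := n) x).mdifferentiableAt hn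
  rw [← descendInvariant_comp_proj hF]
  exact mfderiv_comp x hd hp

/-- **Critical points correspond**: `dF_x̂ = 0 ↔ d(descendInvariant f F)_{proj x̂} = 0` (`dproj`
is bijective). [folklore] -/
theorem mfderiv_eq_zero_iff_mfderiv_descendInvariant_eq_zero [IsManifold I n X] (hn : n ≠ 0)
    (hF : ∀ (k : ℤ) (x : CyclicCover f), F (k +ᵥ x) = F x) {x : CyclicCover f}
    (hFs : ContMDiffAt I J n F x) :
    mfderiv I J F x = 0 ↔ mfderiv I J (descendInvariant f F) (proj x) = 0 := by
  have hcomp := mfderiv_descendInvariant_comp f hn hF hFs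
  have hbij := bijective_mfderiv_cyclicCover_proj f (I := I) hn x
  have hfun : ∀ v : TangentSpace I x, (mfderiv I J F x v : E') =
      mfderiv I J (descendInvariant f F) (proj x)
        (mfderiv I I (proj : CyclicCover f → X) x v) := fun v ↦ by
    rw [hcomp]
    rfl
  constructor
  · intro h0
    ext w
    obtain ⟨v, rfl⟩ := hbij.2 w
    have h := hfun v
    rw [h0] at h
    exact h.symm.trans rfl
  · intro h0
    ext v
    rw [hfun, h0]
    rfl

end Smooth

/-! ### Equivariant real functions are `level + (function on the base)` -/

section Equivariant

variable {X : Type*} [TopologicalSpace X] {f : C(X, Circle)} {F : CyclicCover f → ℝ}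

/-- An equivariant `F` (`F (k +ᵥ x̂) = F x̂ + 2πk`) minus the level function is invariant.
[folklore] -/
theorem invariant_sub_level (hF : ∀ (k : ℤ) (x : CyclicCover f), F (k +ᵥ x) = F x + k * (2 * π))
    (k : ℤ) (x : CyclicCover f) :
    (fun y : CyclicCover f ↦ F y - level y) (k +ᵥ x) = (fun y : CyclicCover f ↦ F y - level y) x := by
  show F (k +ᵥ x) - level (k +ᵥ x) = F x - level x
  rw [hF, level_vadd]
  ring

/-- **Equivariant functions are the level function plus a function on the base**:
`F = level + φ ∘ proj` with `φ = descendInvariant f (F - level)`.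
[cite: HatcherAT2002, §1.3 Prop. 1.40] -/
theorem eq_level_add_descendInvariant_comp_proj
    (hF : ∀ (k : ℤ) (x : CyclicCover f), F (k +ᵥ x) = F x + k * (2 * π)) :
    F = fun x ↦ level x + descendInvariant f (fun y : CyclicCover f ↦ F y - level y) (proj x) := by
  funext x
  rw [descendInvariant_proj (invariant_sub_level hF)]
  ring

/-- Conversely `level + φ ∘ proj` is equivariant. [folklore] -/
theorem level_add_comp_proj_vadd (φ : X → ℝ) (k : ℤ) (x : CyclicCover f) :
    level (k +ᵥ x) + φ (proj (k +ᵥ x)) = (level x + φ (proj x)) + k * (2 * π) := by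
  rw [level_vadd, proj_vadd]
  ring

/-- **Continuous equivariant functions = `level +` continuous functions on the base.** [folklore] -/
theorem exists_eq_level_add_comp_proj
    (hF : ∀ (k : ℤ) (x : CyclicCover f), F (k +ᵥ x) = F x + k * (2 * π)) (hFc : Continuous F) :
    ∃ φ : X → ℝ, Continuous φ ∧ F = fun x ↦ level x + φ (proj x) :=
  ⟨descendInvariant f (fun y : CyclicCover f ↦ F y - level y),
    continuous_descendInvariant (invariant_sub_level hF) (hFc.sub continuous_level),
    eq_level_add_descendInvariant_comp_proj hF⟩

variable {E : Type*} [NormedAddCommGroup E] [NormedSpace ℝ E]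
  {H : Type*} [TopologicalSpace H] {I : ModelWithCorners ℝ E H} [ChartedSpace H X]

/-- **Smooth equivariant functions = `level +` smooth functions on the base** (for a smooth `f`,
so that `level` is `C^∞`, `contMDiff_level`). [cite: LeeSmoothManifolds2013, Thm. 4.29] -/
theorem exists_eq_level_add_comp_proj_contMDiff [IsManifold I ∞ X] {n : ℕ∞ω} (hn : n ≤ ∞)
    (hf : ContMDiff I (𝓡 1) ∞ f)
    (hF : ∀ (k : ℤ) (x : CyclicCover f), F (k +ᵥ x) = F x + k * (2 * π))
    (hFs : ContMDiff I 𝓘(ℝ, ℝ) n F) :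
    ∃ φ : X → ℝ, ContMDiff I 𝓘(ℝ, ℝ) n φ ∧ F = fun x ↦ level x + φ (proj x) := by
  haveI : IsManifold I n X := IsManifold.of_le hn
  exact ⟨descendInvariant f (fun y : CyclicCover f ↦ F y - level y),
    contMDiff_descendInvariant f (invariant_sub_level hF)
      (hFs.sub ((contMDiff_level f hf).of_le hn)),
    eq_level_add_descendInvariant_comp_proj hF⟩

end Equivariant

end Literature.Geometry.Manifold
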